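import Summits.QuantumFields.YangMills.Theorems.BalabanUVNodesN12TowerForestRootsBj
import Literature.MathematicalPhysics.QuantumFieldTheory.Balaban1983to89.T4ForestGaugeCorridorBound
import HarnessLib

/-!
# BalabanUVNodes ∕ N12 — CHAINS OF LATTICE SEGMENTS READ FROM A BASE POINT: composition, lattice paths inside ONE block at any level, and their fine-lattice segment words
# (the bookkeeping half of the (G-c) ROOT CHAINS for the corridor half `hL_corridor` of the interior letter [Balaban1985Variational] (16)–(18))

Cell `pub-ymgap` (HUMAN RULINGS D-0062 ∕ D-0149), WIDTH SEAT `pub-ymgap-dag-n12-w3` g4 (node N12 = [B15]; key K1⁹ `stmt-QuantumFields-27364` (KEY MAP v2), `--kind proof --supports … --as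
helper`; count-neutral).  THEOREMS ONLY (0 `def`, 0 `instance`, 0 `sorry`).

WHY.  dag-n12-w6's `T4ForestGaugeCorridorBound` (p628442 ∕ p630939) bounds a fine bond joining the towers of TWO roots `r₁ ≠ r₂` of the tower forest given ANY fine word `Ω` from `r₁` to `r₂`
whose transporter is comparable to a product of block averages — a CHAIN of member bonds of `𝐁_k(Z)`, each read as the straight fine segment of `L^i` letters between its embedded
endpoints, addressed link by link in the shape `links = pre ++ link :: post` (§3 `dist1_holAt_chain_mul_prod_inv_le`).  This file supplies the lattice bookkeeping for producing such
chains at the record (`…N12BjRootChains`): §1 the composition of the `pre ++ link :: post` consecutiveness under concatenation; §2 a lattice path INSIDE ONE BLOCK between any two of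
its sites at any level `i` (coordinate by coordinate, `Σ_ν |Δlabel_ν|` steps, every step a level-`i` bond with both ends in the block; to the block's centre `≤ d·(L−1)∕2` steps);
§3 the fine reading: a level-`i` step `±e_μ` from `q` is the straight fine word of `L^i` letters `(μ, ±)` from `ι_i q` (`T4ForestGaugeCorridorBound.embIter_tgt_eq_walkEnd_replicate`),
so a level-`i` path maps to a list of links `⟨i, c, ±⟩` whose segment words are consecutive from `ι_i` of its start.

HONEST FRAMING.  Lattice bookkeeping; no analysis; nothing of Bałaban's asserted; N12 NOT discharged; K1⁹ NOT closed; counts unmoved (typed 28∕28 · discharged 5∕27); one finite 𝕋⁴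
programme at fixed ε — R4 closes the conditional rung `BalabanLadder.UV` only; the Yang–Mills mass gap (Clay) is NOT proved by any of this; nothing continuum ∕ ℝ⁴ ∕ OS.
-/

noncomputable section

namespace Summit.QuantumFields.YangMills.BalabanUVNodes.N12BlockChains

open scoped BigOperators
open Literature.MathematicalPhysics.QuantumFieldTheory.Balaban1983to89
open T4Continuum
open B15DeterminingSets
open T4ForestGaugeCorridorBound (embIter_tgt_eq_walkEnd_replicate)

variable {P : Params}

/-! ## §1 Chains of links read consecutively from a base point: composition under concatenation -/

section Generic

variable {j : ℕ} {α : Type*}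

/-- **CHAIN COMPOSITION.**  Links of any type `α`, each spelling a word `f l`; a property `Q (start point) l` asserted for every link of a list at ITS start point `walkEnd r (pre-words)`
(the addressing `links = pre ++ l :: post` of `T4ForestGaugeCorridorBound.dist1_holAt_chain_mul_prod_inv_le`).  If it holds along `L₁` from `r` and along `L₂` from the end of `L₁`, it holds
along `L₁ ++ L₂` from `r`. [folklore] -/
theorem chain_append (f : α → List (Letter P.d)) (Q : Site P j → α → Prop) (r : Site P j) (L₁ L₂ : List α)
    (h₁ : ∀ (pre post : List α) (l : α), L₁ = pre ++ l :: post → Q (walkEnd r (pre.map f).flatten) l)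
    (h₂ : ∀ (pre post : List α) (l : α), L₂ = pre ++ l :: post → Q (walkEnd (walkEnd r (L₁.map f).flatten) (pre.map f).flatten) l) :
    ∀ (pre post : List α) (l : α), L₁ ++ L₂ = pre ++ l :: post → Q (walkEnd r (pre.map f).flatten) l := by
  intro pre post l h
  rcases List.append_eq_append_iff.mp h with ⟨as, hpre, hL₂⟩ | ⟨bs, hL₁, hl⟩
  · -- the link lies in `L₂`: `pre = L₁ ++ as`, `L₂ = as ++ l :: post`
    have hq := h₂ as post l hL₂
    rw [hpre, List.map_append, List.flatten_append, walkEnd_append]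
    exact hq
  · -- `L₁ = pre ++ bs`, `l :: post = bs ++ L₂`
    rcases List.cons_eq_append_iff.mp hl with ⟨hbs, hL₂⟩ | ⟨bs', hbs, hpost⟩
    · -- `bs = []`: the link is the first of `L₂`
      rw [hbs, List.append_nil] at hL₁
      have hq := h₂ [] post l (by rw [hL₂]; rfl)
      rw [hL₁] at hq
      simpa only [List.map_nil, List.flatten_nil, walkEnd] using hq
    · -- the link lies in `L₁`
      rw [hbs] at hL₁
      exact h₁ pre bs' l hL₁

/-- The end of a concatenated chain is the end of the second part read from the end of the first. [folklore] -/
theorem walkEnd_flatten_append (f : α → List (Letter P.d)) (r : Site P j) (L₁ L₂ : List α) :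
    walkEnd r ((L₁ ++ L₂).map f).flatten = walkEnd (walkEnd r (L₁.map f).flatten) (L₂.map f).flatten := by
  rw [List.map_append, List.flatten_append, walkEnd_append]

/-- The total length of the words of a chain with a uniform bound per link. [folklore] -/
theorem length_flatten_le_of_forall_le (f : α → List (Letter P.d)) {N : ℕ} :
    ∀ (L : List α), (∀ l ∈ L, (f l).length ≤ N) → ((L.map f).flatten).length ≤ L.length * N
  | [], _ => by simp
  | l :: L, h => by
      rw [List.map_cons, List.flatten_cons, List.length_append, List.length_cons, Nat.succ_mul, add_comm (L.length * N)]
      exact add_le_add (h l (by simp)) (length_flatten_le_of_forall_le f L fun l' hl' => h l' (by simp [hl']))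

end Generic

/-! ## §2 Lattice paths inside one block, at any level -/

section InBlock

variable {i : ℕ}

/-- The label of `q + e_ν` in direction `ν` is the label of `q` plus one when this does not wrap. [folklore] -/
theorem val_shift_self_of_lt (q : Site P i) (ν : Fin P.d) (h : (q ν).val + 1 < P.sitesPerDir i) : ((q.shift ν) ν).val = (q ν).val + 1 := by
  have h1 : (1 : ZMod (P.sitesPerDir i)).val = 1 := ZMod.val_one _
  rw [Site.shift_apply, if_pos rfl, ZMod.val_add_of_lt (by rw [h1]; exact h), h1]

/-- The label of `q − e_ν` in direction `ν` is the label of `q` minus one when the latter is positive. [folklore] -/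
theorem val_unshift_self_of_pos (q : Site P i) (ν : Fin P.d) (h : 1 ≤ (q ν).val) : ((q.unshift ν) ν).val = (q ν).val - 1 := by
  have h1 : (1 : ZMod (P.sitesPerDir i)).val = 1 := ZMod.val_one _
  rw [Site.unshift_apply, if_pos rfl, ZMod.val_sub (by rw [h1]; exact h), h1]

/-- Two sites agreeing off one coordinate and with the same block label in it lie in the same block. [cite: Balaban1987RG1, (0.3) p.252 (bookkeeping)] -/
theorem blockOf_eq_of_offCoord (hi : i + 1 ≤ P.m + P.K) {q q' : Site P i} (ν : Fin P.d) (hoff : ∀ κ, κ ≠ ν → q' κ = q κ)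
    (hν : (q' ν).val / P.L = (q ν).val / P.L) : blockOf q' = blockOf q := by
  funext κ
  apply ZMod.val_injective
  rw [Site.val_blockOf hi, Site.val_blockOf hi]
  by_cases hκ : κ = ν
  · subst hκ; exact hν
  · rw [hoff κ hκ]

/-- **THE BLOCK OF `q + e_μ` IS THE BLOCK OF `q` OR ITS `μ`-NEIGHBOUR**, at any level (`B10StarCount.blockOf_shift`). [cite: Balaban1987RG1, (0.3) p.252 (bookkeeping)] -/
theorem blockOf_shift_or (hi : i + 1 ≤ P.m + P.K) (q : Site P i) (μ : Fin P.d) :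
    blockOf (q.shift μ) = blockOf q ∨ blockOf (q.shift μ) = (blockOf q).shift μ := by
  rw [B10StarCount.blockOf_shift hi q μ]
  split_ifs
  · exact Or.inr rfl
  · exact Or.inl rfl

/-- ★ **A LATTICE PATH INSIDE ONE BLOCK** between any two of its sites, at any level `i` (`i + 1 ≤ m + K`): by induction on the label distance `Σ_ν |label_ν q₁ − label_ν q₂|`, one step at a
time towards `q₂` in a coordinate where the labels differ (the intermediate labels keep the block label, the blocks being coordinate cubes of integer division by `L`).  Output: a list
of oriented level-`i` bonds, as many as the label distance, every bond with BOTH ends in the block, spelling a walk from `q₁` to `q₂`, each read at its start point in the addressing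
`ch = pre ++ l :: post`. [cite: Balaban1987RG1, (0.3) p.252 (bookkeeping)] -/
theorem exists_blockWalk (hi : i + 1 ≤ P.m + P.K) :
    ∀ (n : ℕ) (q₁ q₂ : Site P i), blockOf q₁ = blockOf q₂ →
      ∑ ν, (((q₁ ν).val - (q₂ ν).val) + ((q₂ ν).val - (q₁ ν).val)) = n →
      ∃ ch : List (PBond P i × Bool), ch.length = n ∧
        (∀ l ∈ ch, blockOf l.1.src = blockOf q₂ ∧ blockOf l.1.tgt = blockOf q₂) ∧
        walkEnd q₁ (ch.map fun l => (l.1.dir, l.2)) = q₂ ∧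
        ∀ (pre post : List (PBond P i × Bool)) (l : PBond P i × Bool), ch = pre ++ l :: post →
          (l.2 = true → walkEnd q₁ (pre.map fun l => (l.1.dir, l.2)) = l.1.src) ∧
          (l.2 = false → walkEnd q₁ (pre.map fun l => (l.1.dir, l.2)) = l.1.tgt)
  | 0, q₁, q₂, hblk, hsum => by
      have hq : q₁ = q₂ := by
        funext ν
        apply ZMod.val_injective
        have h0 := Finset.sum_eq_zero_iff.mp hsum ν (Finset.mem_univ ν)
        omega
      subst hq
      refine ⟨[], rfl, fun l hl => absurd hl List.not_mem_nil, rfl, fun pre post l h => ?_⟩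
      simp at h
  | n + 1, q₁, q₂, hblk, hsum => by
      -- a coordinate where the labels differ
      obtain ⟨ν, -, hν⟩ : ∃ ν ∈ (Finset.univ : Finset (Fin P.d)), ((q₁ ν).val - (q₂ ν).val) + ((q₂ ν).val - (q₁ ν).val) ≠ 0 :=
        Finset.exists_ne_zero_of_sum_ne_zero (by rw [hsum]; exact Nat.succ_ne_zero n)
      set a := (q₁ ν).val with ha
      set b := (q₂ ν).val with hb
      have hab : a ≠ b := by intro h; apply hν; omega
      have hblt : b < P.sitesPerDir i := ZMod.val_lt (q₂ ν)
      have hdiv : a / P.L = b / P.L := by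
        have := congrArg (fun y : Site P (i + 1) => (y ν).val) hblk
        simpa only [Site.val_blockOf hi] using this
      -- the sum splits off the coordinate `ν`
      have hsplit : ∀ w : Site P i, ∑ κ, (((w κ).val - (q₂ κ).val) + ((q₂ κ).val - (w κ).val)) =
          (((w ν).val - (q₂ ν).val) + ((q₂ ν).val - (w ν).val)) + ∑ κ ∈ Finset.univ.erase ν, (((w κ).val - (q₂ κ).val) + ((q₂ κ).val - (w κ).val)) :=
        fun w => (Finset.add_sum_erase _ _ (Finset.mem_univ ν)).symm
      have hrest : ∀ w : Site P i, (∀ κ, κ ≠ ν → w κ = q₁ κ) →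
          ∑ κ ∈ Finset.univ.erase ν, (((w κ).val - (q₂ κ).val) + ((q₂ κ).val - (w κ).val)) =
            ∑ κ ∈ Finset.univ.erase ν, (((q₁ κ).val - (q₂ κ).val) + ((q₂ κ).val - (q₁ κ).val)) := fun w hw =>
        Finset.sum_congr rfl fun κ hκ => by rw [Finset.mem_erase] at hκ; rw [hw κ hκ.1]
      -- the first step `q₁ → q₁'` towards `q₂` in the coordinate `ν`, as an oriented bond `l₀` starting at `q₁`
      obtain ⟨q₁', l₀, hstep, hoff, hval, hstart⟩ : ∃ (q₁' : Site P i) (l₀ : PBond P i × Bool),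
          walkEnd q₁ [(l₀.1.dir, l₀.2)] = q₁' ∧ (∀ κ, κ ≠ ν → q₁' κ = q₁ κ) ∧
          (((q₁' ν).val - b) + (b - (q₁' ν).val) + 1 = (a - b) + (b - a) ∧ (q₁' ν).val / P.L = a / P.L) ∧
          ((l₀.2 = true → q₁ = l₀.1.src ∧ q₁' = l₀.1.tgt) ∧ (l₀.2 = false → q₁ = l₀.1.tgt ∧ q₁' = l₀.1.src)) := by
        rcases lt_or_gt_of_ne hab with hlt | hgt
        · -- `a < b`: step `+e_ν`
          have hv : ((q₁.shift ν) ν).val = a + 1 := val_shift_self_of_lt q₁ ν (by omega)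
          refine ⟨q₁.shift ν, (⟨q₁, ν⟩, true), rfl, fun κ hκ => by rw [Site.shift_apply, if_neg hκ], ?_, ?_⟩
          · rw [hv]
            refine ⟨by omega, ?_⟩
            -- `a/L ≤ (a+1)/L ≤ b/L = a/L`
            exact le_antisymm (hdiv ▸ Nat.div_le_div_right (by omega)) (Nat.div_le_div_right (by omega))
          · exact ⟨fun _ => ⟨rfl, rfl⟩, fun h => absurd h (by simp)⟩
        · -- `b < a`: step `−e_ν`
          have hv : ((q₁.unshift ν) ν).val = a - 1 := val_unshift_self_of_pos q₁ ν (by omega)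
          refine ⟨q₁.unshift ν, (⟨q₁.unshift ν, ν⟩, false), rfl, fun κ hκ => by rw [Site.unshift_apply, if_neg hκ], ?_, ?_⟩
          · rw [hv]
            refine ⟨by omega, ?_⟩
            exact le_antisymm (Nat.div_le_div_right (by omega)) (hdiv ▸ Nat.div_le_div_right (by omega))
          · refine ⟨fun h => absurd h (by simp), fun _ => ⟨?_, rfl⟩⟩
            show q₁ = (q₁.unshift ν).shift ν
            rw [B10StarCount.shift_unshift]
      have hblk' : blockOf q₁' = blockOf q₂ := (blockOf_eq_of_offCoord hi ν hoff hval.2).trans hblk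
      have hsum' : ∑ κ, (((q₁' κ).val - (q₂ κ).val) + ((q₂ κ).val - (q₁' κ).val)) = n := by
        rw [hsplit q₁, ← hb] at hsum
        rw [hsplit q₁', hrest q₁' hoff, ← hb]
        omega
      obtain ⟨ch, hlen, hmem, hend, hcons⟩ := exists_blockWalk hi n q₁' q₂ hblk' hsum'
      refine ⟨l₀ :: ch, by rw [List.length_cons, hlen], ?_, ?_, ?_⟩
      · -- both ends of every bond in the block
        intro l hl
        rcases List.mem_cons.mp hl with rfl | hl
        · have hq₁ : blockOf q₁ = blockOf q₂ := hblk
          cases h2 : l.2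
          · obtain ⟨h1, h2'⟩ := hstart.2 h2; rw [← h1, ← h2']; exact ⟨hblk', hq₁⟩
          · obtain ⟨h1, h2'⟩ := hstart.1 h2; rw [← h1, ← h2']; exact ⟨hq₁, hblk'⟩
        · exact hmem l hl
      · -- the walk ends at `q₂`
        rw [List.map_cons]
        show walkEnd q₁ ([(l₀.1.dir, l₀.2)] ++ ch.map fun l => (l.1.dir, l.2)) = q₂
        rw [walkEnd_append, hstep, hend]
      · -- every link read at its start
        intro pre post l h
        rcases pre with _ | ⟨p, pre'⟩
        · -- the link is `l₀`
          have hl : l = l₀ := (List.cons.inj (by simpa using h)).1.symm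
          subst hl
          simp only [List.map_nil, walkEnd]
          exact ⟨fun h2 => (hstart.1 h2).1, fun h2 => (hstart.2 h2).1⟩
        · obtain ⟨hp, hch⟩ := List.cons.inj (by simpa using h)
          subst hp
          have hc := hcons pre' post l hch
          rw [List.map_cons]
          have hw : ∀ w, walkEnd q₁ ((l₀.1.dir, l₀.2) :: w) = walkEnd q₁' w := fun w => by
            show walkEnd q₁ ([(l₀.1.dir, l₀.2)] ++ w) = walkEnd q₁' w
            rw [walkEnd_append, hstep]
          rw [hw]
          exact hc

/-- **THE LABEL DISTANCE TO THE BLOCK's CENTRE IS `≤ d·(L−1)∕2`**: the centre `emb y` of the block of `y` has labels `y_ν L + (L−1)∕2`, a site of the block labels in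
`[y_ν L, y_ν L + L − 1]` (`L` odd). [cite: Balaban1987RG1, (0.1)–(0.3) pp.251–252 (bookkeeping)] -/
theorem labelDist_emb_le (hi : i + 1 ≤ P.m + P.K) (q : Site P i) (y : Site P (i + 1)) (hq : blockOf q = y) :
    ∑ ν, (((q ν).val - ((emb y) ν).val) + (((emb y) ν).val - (q ν).val)) ≤ P.d * ((P.L - 1) / 2) := by
  have hL := P.L_pos
  have hodd : P.L % 2 = 1 := Nat.odd_iff.mp P.hL.1
  calc ∑ ν, (((q ν).val - ((emb y) ν).val) + (((emb y) ν).val - (q ν).val))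
      ≤ ∑ _ν : Fin P.d, (P.L - 1) / 2 := Finset.sum_le_sum fun ν _ => by
        have hy : (q ν).val / P.L = (y ν).val := by rw [← Site.val_blockOf hi, hq]
        rw [Site.val_emb hi]
        have hdm := Nat.div_add_mod (q ν).val P.L
        have hml := Nat.mod_lt (q ν).val hL
        rw [hy, mul_comm] at hdm
        generalize (y ν).val * P.L = M at hdm ⊢
        generalize (q ν).val % P.L = r at hdm hml
        generalize (q ν).val = a at hdm ⊢
        omega
    _ = P.d * ((P.L - 1) / 2) := by rw [Finset.sum_const, Finset.card_univ, Fintype.card_fin, smul_eq_mul]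

/-- ★ **THE IN-BLOCK PATH, PACKAGED**: between two sites of one block (level `i`, `i + 1 ≤ m + K`) a path of `≤ d·(L−1)` oriented level-`i` bonds with both ends in the block; from or to the
block's CENTRE, `≤ d·(L−1)∕2` of them. [cite: Balaban1987RG1, (0.3) p.252 (bookkeeping)] -/
theorem exists_blockWalk_centre (hi : i + 1 ≤ P.m + P.K) (q₁ q₂ : Site P i) (y : Site P (i + 1)) (hq₁ : blockOf q₁ = y) (hq₂ : blockOf q₂ = y)
    (hctr : q₁ = emb y ∨ q₂ = emb y) :
    ∃ ch : List (PBond P i × Bool), ch.length ≤ P.d * ((P.L - 1) / 2) ∧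
      (∀ l ∈ ch, blockOf l.1.src = y ∧ blockOf l.1.tgt = y) ∧
      walkEnd q₁ (ch.map fun l => (l.1.dir, l.2)) = q₂ ∧
      ∀ (pre post : List (PBond P i × Bool)) (l : PBond P i × Bool), ch = pre ++ l :: post →
        (l.2 = true → walkEnd q₁ (pre.map fun l => (l.1.dir, l.2)) = l.1.src) ∧
        (l.2 = false → walkEnd q₁ (pre.map fun l => (l.1.dir, l.2)) = l.1.tgt) := by
  obtain ⟨ch, hlen, hmem, hend, hcons⟩ := exists_blockWalk hi _ q₁ q₂ (hq₁.trans hq₂.symm) rfl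
  refine ⟨ch, ?_, fun l hl => by rw [← hq₂]; exact hmem l hl, hend, hcons⟩
  rw [hlen]
  rcases hctr with rfl | rfl
  · have h := labelDist_emb_le hi q₂ y hq₂
    calc ∑ ν, ((((emb y) ν).val - (q₂ ν).val) + ((q₂ ν).val - ((emb y) ν).val))
        = ∑ ν, (((q₂ ν).val - ((emb y) ν).val) + (((emb y) ν).val - (q₂ ν).val)) := Finset.sum_congr rfl fun ν _ => add_comm _ _
      _ ≤ _ := h
  · exact labelDist_emb_le hi q₁ y hq₁

end InBlock

/-! ## §3 The fine reading: level-`i` steps are straight fine segments of `L^i` letters -/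

section Fine

variable {i : ℕ}

/-- `ι_i(q + e_μ)` is the end of the straight fine walk of `L^i` letters `+e_μ` from `ι_i q`. [cite: Balaban1987RG1, (0.1) p.251 (bookkeeping)] -/
theorem embIter_shift_eq_walkEnd (i : ℕ) (q : Site P i) (μ : Fin P.d) :
    embIter i (q.shift μ) = walkEnd (embIter i q) (List.replicate (P.L ^ i) (μ, true)) :=
  embIter_tgt_eq_walkEnd_replicate i ⟨q, μ⟩

/-- `ι_i(q − e_μ)` is the end of the straight fine walk of `L^i` letters `−e_μ` from `ι_i q`. [cite: Balaban1987RG1, (0.1) p.251 (bookkeeping)] -/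
theorem embIter_unshift_eq_walkEnd (i : ℕ) (q : Site P i) (μ : Fin P.d) :
    embIter i (q.unshift μ) = walkEnd (embIter i q) (List.replicate (P.L ^ i) (μ, false)) := by
  have h := embIter_shift_eq_walkEnd i (q.unshift μ) μ
  rw [B10StarCount.shift_unshift] at h
  have h' := walkEnd_walkEnd_wordRev (embIter i (q.unshift μ)) (List.replicate (P.L ^ i) (μ, true))
  have hrev : wordRev (List.replicate (P.L ^ i) (μ, true)) = List.replicate (P.L ^ i) ((μ, false) : Letter P.d) := by
    unfold wordRev
    rw [List.map_replicate, List.reverse_replicate]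
    rfl
  rw [← h, hrev] at h'
  exact h'.symm

/-- ★ **A LEVEL-`i` WALK READ ON THE FINE LATTICE**: `ι_i (walkEnd q w) = walkEnd (ι_i q) (every letter of w repeated L^i times)`. [cite: Balaban1987RG1, (0.1) p.251 (bookkeeping)] -/
theorem embIter_walkEnd : ∀ (w : List (Letter P.d)) (q : Site P i),
    embIter i (walkEnd q w) = walkEnd (embIter i q) (w.map fun l => List.replicate (P.L ^ i) l).flatten
  | [], q => rfl
  | (μ, true) :: w, q => by
      rw [List.map_cons, List.flatten_cons, walkEnd_append, ← embIter_shift_eq_walkEnd]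
      exact embIter_walkEnd w (q.shift μ)
  | (μ, false) :: w, q => by
      rw [List.map_cons, List.flatten_cons, walkEnd_append, ← embIter_unshift_eq_walkEnd]
      exact embIter_walkEnd w (q.unshift μ)

/-- The segment words of the links `⟨i, c, ±⟩` of a level-`i` path are the `L^i`-fold letters of the path. [folklore] -/
theorem map_seg_map_mk (ch : List (PBond P i × Bool)) :
    (ch.map fun l => (⟨i, l⟩ : (n : ℕ) × (PBond P n × Bool))).map (fun l => List.replicate (P.L ^ l.1) (l.2.1.dir, l.2.2)) =
      (ch.map fun l => (l.1.dir, l.2)).map fun l => List.replicate (P.L ^ i) l := by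
  rw [List.map_map, List.map_map]
  rfl

/-- ★★ **A LEVEL-`i` PATH AS A CHAIN OF FINE SEGMENTS.**  A list `ch` of oriented level-`i` bonds spelling a walk from `q₁`, each read at its start (`ch = pre ++ l :: post` ⟹ the walk of
the `pre`-letters from `q₁` ends at the start of `l`), becomes the list of links `⟨i, c, ±⟩` whose SEGMENT WORDS `(dir c, ±)^{L^i}` are consecutive from `ι_i q₁`: the concatenated
segments of `pre` end at `ι_i` of the start of `l` (`ι_i c₋` if forward, `ι_i c₊` if backward), and all of them end at `ι_i (walkEnd q₁ ch)`. [cite: Balaban1987RG1, (0.1) p.251 (bookkeeping)] -/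
theorem chain_of_levelWalk (q₁ : Site P i) (ch : List (PBond P i × Bool))
    (hcons : ∀ (pre post : List (PBond P i × Bool)) (l : PBond P i × Bool), ch = pre ++ l :: post →
      (l.2 = true → walkEnd q₁ (pre.map fun l => (l.1.dir, l.2)) = l.1.src) ∧
      (l.2 = false → walkEnd q₁ (pre.map fun l => (l.1.dir, l.2)) = l.1.tgt)) :
    walkEnd (embIter i q₁) ((ch.map fun l => (⟨i, l⟩ : (n : ℕ) × (PBond P n × Bool))).map
        (fun l => List.replicate (P.L ^ l.1) (l.2.1.dir, l.2.2))).flatten =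
      embIter i (walkEnd q₁ (ch.map fun l => (l.1.dir, l.2))) ∧
    ∀ (pre post : List ((n : ℕ) × (PBond P n × Bool))) (l : (n : ℕ) × (PBond P n × Bool)),
      (ch.map fun l => (⟨i, l⟩ : (n : ℕ) × (PBond P n × Bool))) = pre ++ l :: post →
      (l.2.2 = true → walkEnd (embIter i q₁) (pre.map fun l => List.replicate (P.L ^ l.1) (l.2.1.dir, l.2.2)).flatten = embIter l.1 l.2.1.src) ∧
      (l.2.2 = false → walkEnd (embIter i q₁) (pre.map fun l => List.replicate (P.L ^ l.1) (l.2.1.dir, l.2.2)).flatten = embIter l.1 l.2.1.tgt) := by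
  refine ⟨by rw [map_seg_map_mk, embIter_walkEnd], fun pre post l h => ?_⟩
  obtain ⟨pre₀, rest, hch, hpre, hrest⟩ := List.map_eq_append_iff.mp h
  obtain ⟨l₀, post₀, hrest', hl, -⟩ := List.map_eq_cons_iff.mp hrest
  subst hl
  rw [hrest'] at hch
  have hc := hcons pre₀ post₀ l₀ hch
  rw [← hpre, map_seg_map_mk, ← embIter_walkEnd]
  exact ⟨fun h2 => by rw [hc.1 h2], fun h2 => by rw [hc.2 h2]⟩

/-- ★ **CHAINS OF SEGMENT LINKS COMPOSE** (`chain_append` for links `⟨i, c, ±⟩` with their segment words, each read at `ι_i` of its start). [folklore] -/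
theorem links_append (r : Site P 0) (L₁ L₂ : List ((n : ℕ) × (PBond P n × Bool)))
    (h₁ : ∀ (pre post : List ((n : ℕ) × (PBond P n × Bool))) (l : (n : ℕ) × (PBond P n × Bool)), L₁ = pre ++ l :: post →
      (l.2.2 = true → walkEnd r (pre.map fun l => List.replicate (P.L ^ l.1) (l.2.1.dir, l.2.2)).flatten = embIter l.1 l.2.1.src) ∧
      (l.2.2 = false → walkEnd r (pre.map fun l => List.replicate (P.L ^ l.1) (l.2.1.dir, l.2.2)).flatten = embIter l.1 l.2.1.tgt))
    (h₂ : ∀ (pre post : List ((n : ℕ) × (PBond P n × Bool))) (l : (n : ℕ) × (PBond P n × Bool)), L₂ = pre ++ l :: post →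
      (l.2.2 = true → walkEnd (walkEnd r (L₁.map fun l => List.replicate (P.L ^ l.1) (l.2.1.dir, l.2.2)).flatten)
        (pre.map fun l => List.replicate (P.L ^ l.1) (l.2.1.dir, l.2.2)).flatten = embIter l.1 l.2.1.src) ∧
      (l.2.2 = false → walkEnd (walkEnd r (L₁.map fun l => List.replicate (P.L ^ l.1) (l.2.1.dir, l.2.2)).flatten)
        (pre.map fun l => List.replicate (P.L ^ l.1) (l.2.1.dir, l.2.2)).flatten = embIter l.1 l.2.1.tgt)) :
    ∀ (pre post : List ((n : ℕ) × (PBond P n × Bool))) (l : (n : ℕ) × (PBond P n × Bool)), L₁ ++ L₂ = pre ++ l :: post →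
      (l.2.2 = true → walkEnd r (pre.map fun l => List.replicate (P.L ^ l.1) (l.2.1.dir, l.2.2)).flatten = embIter l.1 l.2.1.src) ∧
      (l.2.2 = false → walkEnd r (pre.map fun l => List.replicate (P.L ^ l.1) (l.2.1.dir, l.2.2)).flatten = embIter l.1 l.2.1.tgt) :=
  chain_append (fun l : (n : ℕ) × (PBond P n × Bool) => List.replicate (P.L ^ l.1) (l.2.1.dir, l.2.2))
    (fun (p : Site P 0) (l : (n : ℕ) × (PBond P n × Bool)) => (l.2.2 = true → p = embIter l.1 l.2.1.src) ∧ (l.2.2 = false → p = embIter l.1 l.2.1.tgt))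
    r L₁ L₂ h₁ h₂

end Fine

end Summit.QuantumFields.YangMills.BalabanUVNodes.N12BlockChains

end
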